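import Summits.QuantumFields.YangMills.Theorems.PoincareLipschitzSphereRayProjectionCalculus
import HarnessLib

/-!
# Crux `BlockLipschitzL` (stmt-QuantumFields-23533) ∕ `HistoryTailL` (stmt-QuantumFields-19936), LINE 25 «CompactnessTransfer»,
# K2 continuum face, row (RS) — FILE (RS-a)-normalisation «THE SMOOTH NORMALISATION MAP AND THE DERIVATIVE OF `y ↦ y∕‖y‖`»

Cell `ym3-torus` (YM ladder rung R3 = continuum SU(2) Yang–Mills on T³ — a RUNG, NOT the Clay problem: not d = 4, not
infinite volume, not a mass gap); WIDTH helper seat `ym-ust-19936-w7` g14.  THEOREMS ONLY (0 `def`, 0 `sorry`, default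
heartbeats); imports px22 g7's ✓`PoincareLipschitzSphereRayProjectionCalculus` (the regularised ray projection `N_ε` of
Hardt–Kinderlehrer–Lin, any centre `‖p‖ ≤ ½`), which this file reads AT THE CENTRE `p = 0`, `ε = ¼`: there `π_0 y = y∕‖y‖`
is the normalisation and `N_{1/4}` is a GLOBALLY SMOOTH map with BOUNDED DERIVATIVE (the hypotheses of the chain rule
✓`PoincareLipschitzSobolevChainRule.hasWeakFDerivOn_comp_of_fderiv_bounded`) that equals `y∕‖y‖` off the ball `‖y‖² < 1∕8`.

WHAT IS PROVED (ns `…Theorems.PoincareLipschitzSmoothNormalisation`; any real inner-product space `V`; the map is SPELLED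
OUT in every statement: `N y := Real.smoothTransition (‖y‖ ^ 2 / (1/4) ^ 2 - 1) • (‖y‖⁻¹ • y)`).
* §1 the classical derivative of the normalisation: ★ `hasFDerivAt_normalize` (`y ≠ 0`:
  `D(y∕‖y‖)(h) = ‖y‖⁻¹h − ‖y‖⁻³⟪y,h⟫y`, as the continuous linear map `‖y‖⁻¹•id + (−(‖y‖³)⁻¹•⟪y,·⟫) ⊗ y`) and the
  algebraic identity ★ `norm_normalize_deriv_sq` (`‖‖y‖⁻¹h − ‖y‖⁻³⟪y,h⟫y‖² = (‖y‖²‖h‖² − ⟪y,h⟫²)∕‖y‖⁴`).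
* §2 the smooth normalisation: `smoothNormalize_eq_rayProj` (it IS px22's `N_{1/4}` at centre `0`), ★ `contDiff_smoothNormalize`,
  ★ `exists_norm_fderiv_smoothNormalize_le` (`∃ C, ∀ y, ‖DN y‖ ≤ C`), `smoothNormalize_eq` (`= ‖y‖⁻¹•y` when `1∕8 ≤ ‖y‖²`),
  `norm_smoothNormalize` (`= 1` there), ★ `fderiv_smoothNormalize_apply` (`DN(y)h = ‖y‖⁻¹h − ‖y‖⁻³⟪y,h⟫y` when `1∕8 < ‖y‖²`),
  ★★ `norm_fderiv_smoothNormalize_apply_sq` (`‖DN(y)h‖² = (‖y‖²‖h‖² − ⟪y,h⟫²)∕‖y‖⁴` there).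
HONEST SCOPE.  Calculus of one explicit map; nothing of (RS), (C), S1″, K1, `MeanDeviationL`, `BlockLipschitzL`, `HistoryTailL` is
proved here; YM₃ on T³ is rung R3, not Clay; YM gap NOT proved; no summit statement is proved here. [folklore]

References: R. Hardt, D. Kinderlehrer, F.-H. Lin, Comm. Math. Phys. 105 (1986) 547–570 [HardtKinderlehrerLin1986] (§2);
R. Schoen, K. Uhlenbeck, Invent. Math. 78 (1984) 89–100 [SchoenUhlenbeck1984] (§1: the variations `(u + tφ)∕|u + tφ|`).
-/

set_option autoImplicit false

noncomputable section

open scoped InnerProductSpace ContDiff Topology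
open RealInnerProductSpace Filter Metric Set

namespace Summit.QuantumFields.YangMills.Theorems.PoincareLipschitzSmoothNormalisation

open Summit.QuantumFields.YangMills.Theorems.PoincareLipschitzSphereRayProjectionCalculus

variable {V : Type*} [NormedAddCommGroup V] [InnerProductSpace ℝ V]

/-! ## §1 The classical derivative of `y ↦ y∕‖y‖` -/

/-- ★ **THE DERIVATIVE OF THE NORMALISATION** at `y ≠ 0`:
`D(y∕‖y‖) = ‖y‖⁻¹•id + (−(‖y‖³)⁻¹•⟪y,·⟫) ⊗ y`, i.e. `h ↦ ‖y‖⁻¹h − ‖y‖⁻³⟪y,h⟫y`. [folklore] -/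
theorem hasFDerivAt_normalize {y : V} (hy : y ≠ 0) :
    HasFDerivAt (fun z : V => ‖z‖⁻¹ • z)
      (‖y‖⁻¹ • ContinuousLinearMap.id ℝ V + ((-(‖y‖ ^ 3)⁻¹) • innerSL ℝ y).smulRight y) y := by
  have hny : 0 < ‖y‖ := norm_pos_iff.mpr hy
  have hsq : ‖y‖ ^ 2 ≠ 0 := by positivity
  -- `z ↦ ‖z‖²`
  have h1 : HasFDerivAt (fun z : V => ‖z‖ ^ 2) (2 • innerSL ℝ y) y := (hasStrictFDerivAt_norm_sq y).hasFDerivAt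
  -- `s ↦ (√s)⁻¹` at `s = ‖y‖²`
  have h2 : HasDerivAt (fun s : ℝ => (Real.sqrt s)⁻¹) (-(1 / (2 * Real.sqrt (‖y‖ ^ 2))) / (Real.sqrt (‖y‖ ^ 2)) ^ 2)
      (‖y‖ ^ 2) := by
    have hs := Real.hasDerivAt_sqrt hsq
    exact hs.inv (by rw [Real.sqrt_sq hny.le]; exact hny.ne')
  rw [Real.sqrt_sq hny.le] at h2
  have h3 : HasFDerivAt ((fun s : ℝ => (Real.sqrt s)⁻¹) ∘ fun z : V => ‖z‖ ^ 2)
      ((-(1 / (2 * ‖y‖)) / ‖y‖ ^ 2) • (2 • innerSL ℝ y)) y := h2.comp_hasFDerivAt y h1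
  have h4 : ((fun s : ℝ => (Real.sqrt s)⁻¹) ∘ fun z : V => ‖z‖ ^ 2) = fun z : V => ‖z‖⁻¹ := by
    funext z; simp only [Function.comp_apply, Real.sqrt_sq (norm_nonneg z)]
  rw [h4] at h3
  have h5 : HasFDerivAt (fun z : V => ‖z‖⁻¹ • z)
      (‖y‖⁻¹ • ContinuousLinearMap.id ℝ V + (((-(1 / (2 * ‖y‖)) / ‖y‖ ^ 2) • (2 • innerSL ℝ y)).smulRight y)) y :=
    h3.smul (hasFDerivAt_id y)
  have hsc : (-(1 / (2 * ‖y‖)) / ‖y‖ ^ 2) + (-(1 / (2 * ‖y‖)) / ‖y‖ ^ 2) = -(‖y‖ ^ 3)⁻¹ := by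
    field_simp
    ring
  have h6 : ((-(1 / (2 * ‖y‖)) / ‖y‖ ^ 2) • (2 • innerSL ℝ y)) = (-(‖y‖ ^ 3)⁻¹) • innerSL ℝ y := by
    rw [two_nsmul, smul_add, ← add_smul, hsc]
  rw [h6] at h5
  exact h5

/-- ★ **THE NORM OF THE DERIVATIVE, SQUARED**: for `y ≠ 0` and any `h`,
`‖‖y‖⁻¹•h + (−(‖y‖³)⁻¹·⟪y,h⟫)•y‖² = (‖y‖²‖h‖² − ⟪y,h⟫²)∕‖y‖⁴`. [folklore] -/
theorem norm_normalize_deriv_sq {y : V} (hy : y ≠ 0) (h : V) :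
    ‖‖y‖⁻¹ • h + (-(‖y‖ ^ 3)⁻¹ * ⟪y, h⟫) • y‖ ^ 2 = (‖y‖ ^ 2 * ‖h‖ ^ 2 - ⟪y, h⟫ ^ 2) / ‖y‖ ^ 4 := by
  have hny : 0 < ‖y‖ := norm_pos_iff.mpr hy
  have hny' : ‖y‖ ≠ 0 := hny.ne'
  rw [norm_add_sq_real, norm_smul, norm_smul, real_inner_smul_left, real_inner_smul_right, mul_pow, mul_pow,
    norm_inv, norm_norm, Real.norm_eq_abs, sq_abs, real_inner_comm y h]
  field_simp
  ring

/-! ## §2 The smooth normalisation `N y := σ(16‖y‖² − 1)•(y∕‖y‖)` (`σ` = `Real.smoothTransition`) -/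

/-- The smooth normalisation IS px22's regularised ray projection `N_{1/4}` at the centre `p = 0` (there the root
`−⟪0,e⟫ + √(⟪0,e⟫² + 1 − ‖0‖²)` is `1`). [folklore] -/
theorem smoothNormalize_eq_rayProj :
    (fun y : V => Real.smoothTransition (‖y‖ ^ 2 / (1 / 4) ^ 2 - 1) • (‖y‖⁻¹ • y)) =
      fun y : V => (0 : V) + Real.smoothTransition (‖y - 0‖ ^ 2 / (1 / 4) ^ 2 - 1) •
        ((-⟪(0 : V), ‖y - 0‖⁻¹ • (y - 0)⟫ + Real.sqrt (⟪(0 : V), ‖y - 0‖⁻¹ • (y - 0)⟫ ^ 2 + (1 - ‖(0 : V)‖ ^ 2))) •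
          (‖y - 0‖⁻¹ • (y - 0))) := by
  funext y
  simp

/-- The un-regularised ray projection at the centre `0` is the normalisation `y ↦ y∕‖y‖`. [folklore] -/
theorem rayProj_zero_eq :
    (fun y : V => (0 : V) + (-⟪(0 : V), ‖y - 0‖⁻¹ • (y - 0)⟫ +
        Real.sqrt (⟪(0 : V), ‖y - 0‖⁻¹ • (y - 0)⟫ ^ 2 + (1 - ‖(0 : V)‖ ^ 2))) • (‖y - 0‖⁻¹ • (y - 0))) =
      fun y : V => ‖y‖⁻¹ • y := by
  funext y
  simp

/-- ★ THE SMOOTH NORMALISATION IS `C^∞` on all of `V`. [folklore] -/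
theorem contDiff_smoothNormalize :
    ContDiff ℝ ∞ (fun y : V => Real.smoothTransition (‖y‖ ^ 2 / (1 / 4) ^ 2 - 1) • (‖y‖⁻¹ • y)) := by
  rw [smoothNormalize_eq_rayProj]
  exact contDiff_smoothRayProj (0 : V) (by simp) (by norm_num)

/-- ★ THE SMOOTH NORMALISATION HAS A GLOBALLY BOUNDED DERIVATIVE. [folklore] -/
theorem exists_norm_fderiv_smoothNormalize_le :
    ∃ C : ℝ, ∀ y : V, ‖fderiv ℝ (fun y : V => Real.smoothTransition (‖y‖ ^ 2 / (1 / 4) ^ 2 - 1) • (‖y‖⁻¹ • y)) y‖ ≤ C := by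
  rw [smoothNormalize_eq_rayProj]
  exact exists_norm_fderiv_smoothRayProj_le_const (0 : V) (by simp) (by norm_num)

/-- Off the ball `‖y‖² ≥ 1∕8` the smooth normalisation is `y∕‖y‖`. [folklore] -/
theorem smoothNormalize_eq {y : V} (h : 1 / 8 ≤ ‖y‖ ^ 2) :
    Real.smoothTransition (‖y‖ ^ 2 / (1 / 4) ^ 2 - 1) • (‖y‖⁻¹ • y) = ‖y‖⁻¹ • y := by
  have h' : 2 * (1 / 4 : ℝ) ^ 2 ≤ ‖y - 0‖ ^ 2 := by rw [sub_zero]; linarith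
  have := smoothRayProj_eq_rayProj (0 : V) y (by norm_num : (0 : ℝ) < 1 / 4) h'
  simpa using this

/-- Off the ball `‖y‖² ≥ 1∕8` the smooth normalisation is a unit vector. [folklore] -/
theorem norm_smoothNormalize {y : V} (h : 1 / 8 ≤ ‖y‖ ^ 2) :
    ‖Real.smoothTransition (‖y‖ ^ 2 / (1 / 4) ^ 2 - 1) • (‖y‖⁻¹ • y)‖ = 1 := by
  have hy : y ≠ 0 := by
    intro h0; rw [h0, norm_zero] at h; norm_num at h
  rw [smoothNormalize_eq h, norm_smul, norm_inv, norm_norm, inv_mul_cancel₀ (norm_ne_zero_iff.mpr hy)]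

/-- ★ **THE DERIVATIVE OF THE SMOOTH NORMALISATION off the ball `‖y‖² > 1∕8`**: `DN(y) = ‖y‖⁻¹•id + (−(‖y‖³)⁻¹•⟪y,·⟫) ⊗ y`.
[folklore] -/
theorem fderiv_smoothNormalize {y : V} (h : 1 / 8 < ‖y‖ ^ 2) :
    fderiv ℝ (fun y : V => Real.smoothTransition (‖y‖ ^ 2 / (1 / 4) ^ 2 - 1) • (‖y‖⁻¹ • y)) y =
      ‖y‖⁻¹ • ContinuousLinearMap.id ℝ V + ((-(‖y‖ ^ 3)⁻¹) • innerSL ℝ y).smulRight y := by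
  have hy : y ≠ 0 := by
    intro h0; rw [h0, norm_zero] at h; norm_num at h
  have h' : 2 * (1 / 4 : ℝ) ^ 2 < ‖y - 0‖ ^ 2 := by rw [sub_zero]; linarith
  rw [smoothNormalize_eq_rayProj, fderiv_smoothRayProj_eq_fderiv_rayProj (0 : V) y (by norm_num : (0 : ℝ) < 1 / 4) h',
    rayProj_zero_eq]
  exact (hasFDerivAt_normalize hy).fderiv

/-- ★ the derivative applied to a vector: `DN(y)h = ‖y‖⁻¹•h + (−(‖y‖³)⁻¹·⟪y,h⟫)•y` (`‖y‖² > 1∕8`). [folklore] -/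
theorem fderiv_smoothNormalize_apply {y : V} (h : 1 / 8 < ‖y‖ ^ 2) (v : V) :
    fderiv ℝ (fun y : V => Real.smoothTransition (‖y‖ ^ 2 / (1 / 4) ^ 2 - 1) • (‖y‖⁻¹ • y)) y v =
      ‖y‖⁻¹ • v + (-(‖y‖ ^ 3)⁻¹ * ⟪y, v⟫) • y := by
  rw [fderiv_smoothNormalize h]
  simp only [add_apply, smul_apply, ContinuousLinearMap.coe_id', id, ContinuousLinearMap.smulRight_apply,
    innerSL_apply_apply, smul_eq_mul]

/-- ★★ **THE NORMALISED DENSITY**: `‖DN(y)h‖² = (‖y‖²‖h‖² − ⟪y,h⟫²)∕‖y‖⁴` for `‖y‖² > 1∕8`. [folklore] -/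
theorem norm_fderiv_smoothNormalize_apply_sq {y : V} (h : 1 / 8 < ‖y‖ ^ 2) (v : V) :
    ‖fderiv ℝ (fun y : V => Real.smoothTransition (‖y‖ ^ 2 / (1 / 4) ^ 2 - 1) • (‖y‖⁻¹ • y)) y v‖ ^ 2 =
      (‖y‖ ^ 2 * ‖v‖ ^ 2 - ⟪y, v⟫ ^ 2) / ‖y‖ ^ 4 := by
  have hy : y ≠ 0 := by
    intro h0; rw [h0, norm_zero] at h; norm_num at h
  rw [fderiv_smoothNormalize_apply h, norm_normalize_deriv_sq hy]

end Summit.QuantumFields.YangMills.Theorems.PoincareLipschitzSmoothNormalisation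

end
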